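import Summits.BirchSwinnertonDyer.BirchSwinnertonDyer.Theorems.GenusKolyvaginAtTwoPowDvdShaCardAtTwoRTOrderFourAuxiliary
import HarnessLib

/-!
# Route `GenusKolyvaginAtTwo`, crux L_T `PowDvdShaCardAtTwoRT` (stmt-BirchSwinnertonDyer-23242), LINE 18 stub L, bottom rung:
# THE ORDER-4 AUXILIARY CLASS WITH ARBITRARY CONDITIONS OF ORDER `≥ 8` AT THE DEEP OWN PRIMES

Seat `bsd-line-gk2-p3` g21 (PROVER seat 3/3, cell `bsd-f1-sign2`), `--supports 23242 --as helper`.  THEOREMS ONLY; no `sorry`;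
standard axioms.  BSD is NOT proved by any of this; neither is the crux nor stub L.

WHY (LEAD memo `Cruxes/PowDvdShaCardAtTwoRT/Lines/plus-descent-lead-g16.md` §2, §7 (i), §8).  The bottom-rung engine of LINE 18 for
index-`≥ 2` witnesses pairs `X = 2·desc c₂(nℓ′)` with an auxiliary class `y ∈ H¹(ℚ, E[4])` of ORDER `4`, Kummer off the primes of
the `k`-minimal primitive product `n = s·t`, FREE at the `k ≥ 1` non-deep own primes `s` and subject, at each DEEP own prime `ℓ ∈ t`,
to a local condition `M_ℓ ≤ H¹(ℚ_ℓ, E[4])` of ORDER `8` (the LEAD's `H′_ℓ = res⁻¹(values in ℤN_s)` of §2, or `(2•)⁻¹ H¹_tr =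
H¹_tr ⊕ H¹_f[2]` of §8, or the annihilator of the doubled own-prime localisation).  The LEAD's `…RTOrderFourAuxiliary`
(`exists_mem_kummerOutside_four_two_nsmul_ne_zero`, p698989) is the instance `t = ∅` (every place of `T` free).  THIS FILE is the
general instance, typed so that the IDENTITY of the order-8 condition is irrelevant: for ANY family of local conditions `M_u`
(`u ∈ T`) with `8 ≤ #M_u` everywhere and `M_{u₀} = ⊤` at ONE place, the solution group
`𝒴 = H¹_{𝓛, ⊤ on T}(ℚ, E[4]) ⊓ loc⁻¹(Π M_u)` contains a class `y` with `2•y ≠ 0`.  Numbers: `#H¹(ℚ_ℓ, E[2])·#H¹(ℚ_ℓ, E[4]) = 4·16 = 64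
≤ (#M_ℓ)²` at every place, `< 256 = 16²` at the free one, so `∏_T 64 < (∏_T #M_u)²` — the hypothesis of the LEAD's
`…RTRelaxedCountKummer.exists_mem_solutions_nsmul_ne_zero_canonical`; the level map `H¹(E[2] ↪ E[4])` and its four displayed
properties are discharged exactly as in the LEAD's file (`…RTLevelRange`, `VisiblePairAtTwo.torsionH1OfDvd_pow_injective`).

* `prod_mul_lt_sq_prod_of_le_of_lt` — the numerical bookkeeping (`a_u·b_u ≤ m_u²` everywhere, `<` somewhere ⟹ `∏a·∏b < (∏m)²`).
* **`exists_mem_kummerOutside_four_localization_mem_two_nsmul_ne_zero`** — the general order-4 auxiliary (conditions displayed as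
  `∀ u, loc_u y ∈ M u`).
* `exists_mem_kummerOutside_four_localization_mem_two_nsmul_ne_zero_of_index_two` — the same with the order hypothesis stated as
  «`M_u` has index `≤ 2` in `H¹(ℚ_u, E[4])`» (the shape of an annihilator of one class of order `≤ 2`, e.g. of `X_ℓ = 2Z_ℓ`).

HONEST FRAMING: unconditional bookkeeping over the LEAD's canonical count (Poitou–Tate for the canonical family, Tate's local Euler
characteristic, Weil pairing — tree theorems); which order-8 condition the engine uses at the deep own primes, and that
`Z_ℓ = loc_ℓ desc c₂(nℓ′)` satisfies it, is NOT here.  Closes nothing.  BSD is NOT proved by any of this.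

References: [McCallumLMS1991] §2 Prop. 2.1, §5 Lemma 5.3 and proof of Prop. 5.2; [MilneADT2006] Ch. I Thm. 2.8, Cor. 2.3, Thm. 4.10.
-/

set_option autoImplicit false
-- the Theorems namespace of this sub repeats the summit name by design (D-0017 nested layout)
set_option linter.dupNamespace false

noncomputable section

open scoped Classical

open CategoryTheory Field NumberField IsDedekindDomain Function
open _root_.WeierstrassCurve
open Literature.NumberTheory.EllipticCurves
open Literature.NumberTheory.GaloisRepresentations
open Literature.NumberTheory.GaloisCohomology
open Summit.BirchSwinnertonDyer.Rank1Residual.X11b.KummerPT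
open Summit.BirchSwinnertonDyer.Rank1Residual.X11b.FiniteDuality
open Summit.BirchSwinnertonDyer.Rank1Residual.X11b.LocBridge Summit.BirchSwinnertonDyer.Rank1Residual.X11b.Levels
open scoped ContRepresentation

namespace Summit.BirchSwinnertonDyer.BirchSwinnertonDyer.Theorems.GenusExact.RelaxedCount

open Summit.BirchSwinnertonDyer.BirchSwinnertonDyer.Theorems.GenusExact.ReductionCyclic
open Summit.BirchSwinnertonDyer.BirchSwinnertonDyer.Theorems.GenusExact.LocalDualityOrder

/-! ## §1 Numerical bookkeeping -/

/-- **`∏ a · ∏ b < (∏ m)²`** when `a_u · b_u ≤ m_u²` at every index, `a_u · b_u > 0`, and the inequality is strict at one index.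
[folklore] -/
theorem prod_mul_lt_sq_prod_of_le_of_lt {ι : Type*} (s : Finset ι) (a b m : ι → ℕ)
    (hpos : ∀ u ∈ s, 0 < a u * b u) (hle : ∀ u ∈ s, a u * b u ≤ m u ^ 2) (hlt : ∃ u ∈ s, a u * b u < m u ^ 2) :
    (∏ u ∈ s, a u) * (∏ u ∈ s, b u) < (∏ u ∈ s, m u) ^ 2 := by
  rw [← Finset.prod_mul_distrib, ← Finset.prod_pow]
  exact Finset.prod_lt_prod hpos hle hlt

variable (W : WeierstrassCurve ℚ) [W.IsElliptic] [W.IsGloballyMinimal]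

/-! ## §2 The order-4 auxiliary with arbitrary conditions of order `≥ 8` -/

/-- **The order-4 auxiliary class with arbitrary local conditions of order `≥ 8` on `T`.**  `E/ℚ` with `Δ < 0` and `ρ̄_{E,2}` onto
(so `E(ℚ)[2] = 0`); `T` a finite set of places, each the place of a Gross–Kolyvagin prime `ℓ ≠ 2` of good reduction with
`Frob_ℓ = Frob_∞` and `kolyvaginIndex ≥ 2` (so `#H¹(ℚ_ℓ, E[2]) = 4`, `#H¹(ℚ_ℓ, E[4]) = 16`); `M_u ≤ H¹(ℚ_u, E[4])` (`u ∈ T`) ANY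
subgroups with `8 ≤ #M_u`, and `M_{u₀} = ⊤` for SOME `u₀ ∈ T` (a free place).  Then there is
**`y ∈ H¹_{𝓛, ⊤ on T}(ℚ, E[4])` with `loc_u y ∈ M_u` for all `u ∈ T` and `2•y ≠ 0`.**  Proof: the LEAD's
`exists_mem_solutions_nsmul_ne_zero_canonical` at levels `(2,4)`, level map `H¹(E[2] ↪ E[4])`; numbers `∏_T (4·16) < (∏_T #M_u)²`
since `64 ≤ 8²` termwise and `64 < 16²` at `u₀`.  With `M_u = ⊤` everywhere this is the LEAD's `t = ∅` instance
(`exists_mem_kummerOutside_four_two_nsmul_ne_zero`); with `#M_ℓ = 8` at the deep own primes it is the general bottom-rung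
auxiliary of memo §2/§8. [cite: McCallumLMS1991, §2 Prop. 2.1 and §5 proof of Prop. 5.2] [cite: MilneADT2006, Ch. I, Thm. 4.10] -/
theorem exists_mem_kummerOutside_four_localization_mem_two_nsmul_ne_zero (hΔ : W.Δ < 0)
    (hρ2 : W.HasSurjectiveModNGaloisRep 2)
    {K : Type} [Field K] [NumberField K] (T : Finset (Place ℚ))
    (hTK : ∀ u ∈ T, ∃ (v : HeightOneSpectrum (𝓞 ℚ)) (ℓ : ℕ) (_ : Fact ℓ.Prime), u = Sum.inr v ∧ ℓ ≠ 2 ∧ (ℓ : 𝓞 ℚ) ∈ v.asIdeal ∧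
      W.HasGoodReductionAtPrime ℓ ∧ FrobEqFrobInfty W K 2 ℓ ∧ 2 ≤ Zhang2014.kolyvaginIndex W 2 ℓ)
    (M : ∀ u : ↥T, AddSubgroup (galoisCohomology ((W.torsionGaloisModule ((2 ^ 2 : ℕ) : ℤ)).toLocal (u : Place ℚ)) 1))
    (hM8 : ∀ u : ↥T, 8 ≤ Nat.card (M u)) (hfree : ∃ u₀ : ↥T, M u₀ = ⊤) :
    ∃ y ∈ kummerOutside W (2 ^ 2) T,
      (∀ u : ↥T, galoisCohomology.localization (W.torsionGaloisModule ((2 ^ 2 : ℕ) : ℤ)) (u : Place ℚ) 1 y ∈ M u) ∧ 2 • y ≠ 0 := by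
  classical
  haveI : Fact (Nat.Prime 2) := ⟨Nat.prime_two⟩
  -- local counts on `T`
  have hcount : ∀ (N : ℕ), N ≠ 0 → N ≤ 2 → ∀ u : ↥T,
      Nat.card (galoisCohomology ((W.torsionGaloisModule ((2 ^ N : ℕ) : ℤ)).toLocal (u : Place ℚ)) 1) = 4 ^ N := by
    intro N hN0 hN2 u
    obtain ⟨v, ℓ, hℓp, hu, hℓ2, hv, hgood, hFrob, hidx⟩ := hTK u u.2
    rw [hu]
    exact natCard_galoisCohomology_one_toLocal_two_pow_eq W hΔ hℓ2 hgood hFrob hv hN0 (hN2.trans hidx)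
  -- Weil pairings at levels 2 and 4
  obtain ⟨e₂, hμ₂, hadd₁₂, hadd₂₂, halt₂, hnondeg₂, hgal₂⟩ :=
    W.exists_weilPairing_holds (2 ^ 1) (by norm_num) (by norm_num)
  obtain ⟨e₄, hμ₄, hadd₁₄, hadd₂₄, halt₄, hnondeg₄, hgal₄⟩ :=
    W.exists_weilPairing_holds (2 ^ 2) (by norm_num) (by norm_num)
  -- product localisations
  set loc₂ : galoisCohomology (W.torsionGaloisModule ((2 ^ 1 : ℕ) : ℤ)) 1 →+
      (∀ u : ↥T, galoisCohomology ((W.torsionGaloisModule ((2 ^ 1 : ℕ) : ℤ)).toLocal (u : Place ℚ)) 1) :=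
    AddMonoidHom.pi fun u ↦ galoisCohomology.localization (W.torsionGaloisModule ((2 ^ 1 : ℕ) : ℤ)) (u : Place ℚ) 1 with hloc₂d
  set loc₄ : galoisCohomology (W.torsionGaloisModule ((2 ^ 2 : ℕ) : ℤ)) 1 →+
      (∀ u : ↥T, galoisCohomology ((W.torsionGaloisModule ((2 ^ 2 : ℕ) : ℤ)).toLocal (u : Place ℚ)) 1) :=
    AddMonoidHom.pi fun u ↦ galoisCohomology.localization (W.torsionGaloisModule ((2 ^ 2 : ℕ) : ℤ)) (u : Place ℚ) 1 with hloc₄d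
  have hloc₂ : ∀ c u, loc₂ c u = galoisCohomology.localization (W.torsionGaloisModule ((2 ^ 1 : ℕ) : ℤ)) (u : Place ℚ) 1 c :=
    fun c u ↦ rfl
  have hloc₄ : ∀ c u, loc₄ c u = galoisCohomology.localization (W.torsionGaloisModule ((2 ^ 2 : ℕ) : ℤ)) (u : Place ℚ) 1 c :=
    fun c u ↦ rfl
  -- the level map
  have hdvd : ((2 ^ 1 : ℕ) : ℤ) ∣ ((2 ^ (1 + 1) : ℕ) : ℤ) := by norm_num
  have hι : Injective (galoisCohomology.map (W.torsionInclusion hdvd) 1) := by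
    intro x y hxy
    rw [map_torsionInclusion_one_apply, map_torsionInclusion_one_apply] at hxy
    exact VisiblePairAtTwo.torsionH1OfDvd_pow_injective W (p := 2) (VisiblePairAtTwo.torsionBy_two_eq_bot_of_surj W hρ2) hdvd hxy
  -- the numerical hypothesis: `∏ 4 · ∏ 16 < (∏ #M_u)²`
  have h2 : ∀ u : ↥T, Nat.card (galoisCohomology ((W.torsionGaloisModule ((2 ^ 1 : ℕ) : ℤ)).toLocal (u : Place ℚ)) 1) = 4 :=
    fun u ↦ by rw [hcount 1 one_ne_zero (by norm_num) u, pow_one]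
  have h4 : ∀ u : ↥T, Nat.card (galoisCohomology ((W.torsionGaloisModule ((2 ^ (1 + 1) : ℕ) : ℤ)).toLocal (u : Place ℚ)) 1) =
      16 := fun u ↦ by rw [hcount (1 + 1) (by norm_num) le_rfl u]; norm_num
  obtain ⟨u₀, hu₀⟩ := hfree
  have hM16 : Nat.card (M u₀) = 16 := by rw [hu₀, AddSubgroup.card_top]; exact h4 u₀
  have hlt : (∏ u : ↥T, Nat.card (galoisCohomology ((W.torsionGaloisModule ((2 ^ 1 : ℕ) : ℤ)).toLocal (u : Place ℚ)) 1)) *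
      (∏ u : ↥T, Nat.card (galoisCohomology ((W.torsionGaloisModule ((2 ^ (1 + 1) : ℕ) : ℤ)).toLocal (u : Place ℚ)) 1)) <
      (∏ u : ↥T, Nat.card (M u)) ^ 2 := by
    refine prod_mul_lt_sq_prod_of_le_of_lt _ _ _ _ (fun u _ ↦ by rw [h2 u, h4 u]; norm_num)
      (fun u _ ↦ ?_) ⟨u₀, Finset.mem_univ _, by rw [h2 u₀, h4 u₀, hM16]; norm_num⟩
    rw [h2 u, h4 u]
    calc 4 * 16 = 8 ^ 2 := by norm_num
      _ ≤ Nat.card (M u) ^ 2 := Nat.pow_le_pow_left (hM8 u) 2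
  obtain ⟨y, hy, hy2⟩ := exists_mem_solutions_nsmul_ne_zero_canonical W 2 1 (1 + 1) e₂ hμ₂ hadd₁₂ hadd₂₂ hgal₂ halt₂ hnondeg₂
    e₄ hμ₄ hadd₁₄ hadd₂₄ hgal₄ halt₄ hnondeg₄ one_pos (by norm_num) 2 T loc₂ hloc₂ loc₄ hloc₄
    (galoisCohomology.map (W.torsionInclusion hdvd) 1) hι
    (fun c hc ↦ (map_torsionInclusion_mem_kummerOutside_iff W hdvd T c).mpr hc)
    (fun y hyT hy ↦ exists_map_torsionInclusion_eq_of_mem_kummerOutside W 2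
      (VisiblePairAtTwo.torsionBy_two_eq_bot_of_surj W hρ2) 1 1 hdvd T y hyT (by simpa using hy))
    (fun c u hc ↦ by
      rw [hloc₄]
      exact localization_map_torsionInclusion_eq_zero W hdvd (u : Place ℚ) c (by rw [← hloc₂]; exact hc))
    M hlt
  have hy' : loc₄ y ∈ AddSubgroup.pi Set.univ M := AddSubgroup.mem_comap.mp (AddSubgroup.mem_inf.mp hy).2
  refine ⟨y, (AddSubgroup.mem_inf.mp hy).1, fun u ↦ ?_, hy2⟩
  rw [← hloc₄]
  exact (AddSubgroup.mem_pi _).mp hy' u (Set.mem_univ _)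

/-- **The same, with the order hypothesis in index form.**  If every `M_u` has index `≤ 2` in `H¹(ℚ_u, E[4])` (e.g. `M_u` is the
annihilator, under the local Weil–Tate pairing, of a single class of order `≤ 2` — such as the doubled own-prime localisation
`X_ℓ = 2·Z_ℓ` of memo §2/§8 — or `M_u = H¹_tr ⊕ H¹_f[2]`), then `#M_u ≥ 16/2 = 8`, and the order-4 auxiliary exists as soon as one
place of `T` is free. [cite: McCallumLMS1991, §2 Prop. 2.1 and §5 proof of Prop. 5.2] -/
theorem exists_mem_kummerOutside_four_localization_mem_two_nsmul_ne_zero_of_index_le_two (hΔ : W.Δ < 0)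
    (hρ2 : W.HasSurjectiveModNGaloisRep 2)
    {K : Type} [Field K] [NumberField K] (T : Finset (Place ℚ))
    (hTK : ∀ u ∈ T, ∃ (v : HeightOneSpectrum (𝓞 ℚ)) (ℓ : ℕ) (_ : Fact ℓ.Prime), u = Sum.inr v ∧ ℓ ≠ 2 ∧ (ℓ : 𝓞 ℚ) ∈ v.asIdeal ∧
      W.HasGoodReductionAtPrime ℓ ∧ FrobEqFrobInfty W K 2 ℓ ∧ 2 ≤ Zhang2014.kolyvaginIndex W 2 ℓ)
    (M : ∀ u : ↥T, AddSubgroup (galoisCohomology ((W.torsionGaloisModule ((2 ^ 2 : ℕ) : ℤ)).toLocal (u : Place ℚ)) 1))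
    (hM2 : ∀ u : ↥T, (M u).index ≤ 2) (hfree : ∃ u₀ : ↥T, M u₀ = ⊤) :
    ∃ y ∈ kummerOutside W (2 ^ 2) T,
      (∀ u : ↥T, galoisCohomology.localization (W.torsionGaloisModule ((2 ^ 2 : ℕ) : ℤ)) (u : Place ℚ) 1 y ∈ M u) ∧ 2 • y ≠ 0 := by
  classical
  haveI : Fact (Nat.Prime 2) := ⟨Nat.prime_two⟩
  refine exists_mem_kummerOutside_four_localization_mem_two_nsmul_ne_zero W hΔ hρ2 T hTK M (fun u ↦ ?_) hfree
  obtain ⟨v, ℓ, hℓp, hu, hℓ2, hv, hgood, hFrob, hidx⟩ := hTK u u.2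
  have h16 : Nat.card (galoisCohomology ((W.torsionGaloisModule ((2 ^ 2 : ℕ) : ℤ)).toLocal (u : Place ℚ)) 1) = 16 := by
    rw [hu, natCard_galoisCohomology_one_toLocal_two_pow_eq W hΔ hℓ2 hgood hFrob hv two_ne_zero hidx]; norm_num
  haveI : Finite (galoisCohomology ((W.torsionGaloisModule ((2 ^ 2 : ℕ) : ℤ)).toLocal (u : Place ℚ)) 1) :=
    Nat.finite_of_card_ne_zero (by rw [h16]; norm_num)
  have hmul := (M u).card_mul_index
  rw [h16] at hmul
  have hidx0 : 0 < (M u).index := Nat.pos_of_ne_zero (M u).index_ne_zero_of_finite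
  -- `#M · index = 16`, `index ≤ 2` ⟹ `#M ≥ 8`
  rcases Nat.lt_or_ge (Nat.card (M u)) 8 with h | h
  · exfalso
    have : Nat.card (M u) * (M u).index ≤ 7 * 2 := Nat.mul_le_mul (by omega) (hM2 u)
    omega
  · exact h

end Summit.BirchSwinnertonDyer.BirchSwinnertonDyer.Theorems.GenusExact.RelaxedCount

end
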